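import Mathlib
import Literature.NumberTheory.Transcendental.LindemannWeierstrassProofs
import Literature.Algebra.Polynomial.AffineSliceCalculus
import Summits.Schanuel.Schanuel.Theorems.AclSubsetLogFreeCore.Negative.LogTwoBranchRelations

/-!
# Crux `AclSubsetLogFreeCore` — polynomial relations between branches of `log 2` and `log 3`
# feed the hub UNCONDITIONALLY (cdisprove gen 4, part 3)

Continuation of `LogTwoHub.lean` / `LogTwoBranchRelations.lean` (crux stmt-Schanuel-0968,
(A) `acl^{ℂ_exp}(∅) ⊆ C_EA`).  Part 2 fed the hub `ln 2 ∈ dcl^{ℂ_exp}(∅)` from an accidental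
ALGEBRAIC relation `R(ln 2 + 2πij, ln 3 + 2πik) = 0` modulo the route's Baker-level support item
Theorem L (finiteness of the relation set).  For POLYNOMIAL relations `ln 3 + 2πik = S(ln 2 + 2πij)`,
`S ∈ ℤ[X]`, no Baker input is needed: this file proves, from Hermite–Lindemann alone
(`Literature.NumberTheory.Transcendental.transcendental_exp_holds`, PROVED in the tree), that

* §3 `{x | e^x = 2 ∧ e^{S(x)} = 3}` is FINITE for every `S ∈ ℤ[X]` (`finite_polyRelationSet`).
  Proof: its points are `x_j = ln 2 + 2πij` with `S(x_j) ∈ ln 3 + 2πiℤ`, so `S(x_j) + S(x_{-j}) = 2 ln 3`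
  (`conj S(x_j) = S(x_{-j})`); hence `j` is a root of `E = p(T) + p(-T) − 2 ln 3`, `p(T) = S(ln 2 + 2πiT)`,
  and `E ≠ 0` (`linePoly_add_reflect_ne`): by Taylor's formula `p_k = (2πi)^k·(H_k S)(ln 2)` (Hasse
  derivatives), and `E = 0` would force `(H_k S)(ln 2) = 0` for all even `k ≥ 2` and `S(ln 2) = ln 3`;
  for `deg S = n ≥ 2` even the leading coefficient dies, for `n ≥ 3` odd `(H_{n-1}S)(ln 2) =
  a_{n-1} + n a_n ln 2 = 0` makes `ln 2` rational, and for `n ≤ 1` `ln 3 = a₁ ln 2 + a₀` contradicts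
  Hermite–Lindemann (`e^{a₀} = 3·2^{-a₁}` algebraic) or `2^p ≠ 3^q`.
* §4 Consequently (via conjugation averaging, `LogTwoHub`): ONE polynomial relation
  `S(ln 2 + 2πij) = ln 3 + 2πik` puts `ln 2` in `dcl(∅)` (`log_two_mem_expDcl_of_polyRelation`), so
  **(A) ⇒ `ln 2 ∈ C_EA` ∨ no branch of `log 3` is an integer polynomial in a branch of `log 2`**
  (`logFree_or_noPolyRelation_of_crux`) — UNCONDITIONALLY a disjunction of an SC-false statement and an
  open one (already `ln 3 ≠ m·ln²2 + r` is open); and **one automorphism of `ℂ_exp` moving `ln 2`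
  proves `ln 3 + 2πik ∉ ℤ[ln 2 + 2πij]` for all `j, k`** (`noPolyRelation_of_equiv_apply_ne`) — an
  unconditional "symmetry ⇒ transcendence" transfer about TWO logarithms, beyond Baker's linear forms.

## References

* A. Baker, *Transcendental number theory*, CUP 1975, Ch. 1 Thm 1.4 (Hermite–Lindemann).
* M. Waldschmidt, *Diophantine approximation on linear algebraic groups*, Springer 2000, §1.4
  (algebraic independence of logarithms is open beyond the linear case).
-/

noncomputable section

set_option linter.dupNamespace false

open FirstOrder FirstOrder.Language Set
open Literature.ModelTheory.ExponentialFields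
open Polynomial

namespace Summit.Schanuel.Schanuel.Theorems.AclSubsetLogFreeCore.Negative

/-! ## §1 Transcendence inputs (Hermite–Lindemann only) -/

/-- `ln 2` is transcendental: otherwise `2 = e^{ln 2}` would be transcendental. [cite: BakerTNT1975, Ch. 1 Thm 1.4] -/
theorem transcendental_log_two : Transcendental ℚ (Real.log 2 : ℂ) := by
  intro halg
  have hne : (Real.log 2 : ℂ) ≠ 0 := by exact_mod_cast (Real.log_pos one_lt_two).ne'
  refine Literature.NumberTheory.Transcendental.transcendental_exp_holds halg hne ?_
  rw [exp_log_two]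
  exact_mod_cast isAlgebraic_nat (R := ℚ) (A := ℂ) 2

/-- `ln 2` is irrational. [folklore] -/
theorem log_two_ne_ratCast (q : ℚ) : Real.log 2 ≠ (q : ℝ) := by
  intro h
  apply transcendental_log_two
  rw [show ((Real.log 2 : ℝ) : ℂ) = ((q : ℝ) : ℂ) by rw [h], Complex.ofReal_ratCast]
  simpa using isAlgebraic_algebraMap (R := ℚ) (A := ℂ) q

/-- `3 ≠ 2^a` for rational `a` (`3^q` is odd). [folklore] -/
theorem three_ne_two_rpow_ratCast (a : ℚ) : (3 : ℝ) ≠ (2 : ℝ) ^ (a : ℝ) := by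
  intro h3
  have hand : (a : ℝ) = (a.num : ℝ) / (a.den : ℝ) := by exact_mod_cast (Rat.num_div_den a).symm
  have hdpos : 0 < a.den := a.den_pos
  have h3d : (3 : ℝ) ^ (a.den : ℕ) = (2 : ℝ) ^ (a.num : ℤ) := by
    have : ((2 : ℝ) ^ (a : ℝ)) ^ (a.den : ℕ) = (2 : ℝ) ^ (a.num : ℝ) := by
      rw [← Real.rpow_natCast, ← Real.rpow_mul two_pos.le, hand]
      congr 1
      field_simp
    rw [h3, this, Real.rpow_intCast]
  have hnum : 0 ≤ a.num := by
    by_contra hneg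
    push Not at hneg
    have hlt : (2 : ℝ) ^ (a.num : ℤ) < 1 := zpow_lt_one_of_neg₀ (by norm_num) hneg
    have hge : (1 : ℝ) ≤ (3 : ℝ) ^ (a.den : ℕ) := one_le_pow₀ (by norm_num)
    linarith
  obtain ⟨n, hn⟩ := Int.eq_ofNat_of_zero_le hnum
  rw [hn, zpow_natCast] at h3d
  have hnat : (3 : ℕ) ^ a.den = 2 ^ n := by exact_mod_cast h3d
  rcases Nat.eq_zero_or_pos n with hn0 | hnpos
  · rw [hn0, pow_zero] at hnat
    have : a.den = 0 := (Nat.pow_eq_one.1 hnat).resolve_left (by norm_num)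
    omega
  · have h2dvd : 2 ∣ 3 ^ a.den := ⟨2 ^ (n - 1), by
      rw [hnat, ← pow_succ', Nat.sub_add_cancel hnpos]⟩
    have := Nat.Prime.dvd_of_dvd_pow Nat.prime_two h2dvd
    omega

/-- `2^a` is algebraic for rational `a`. [folklore] -/
theorem isAlgebraic_two_rpow_ratCast (a : ℚ) : IsAlgebraic ℚ ((2 : ℝ) ^ (a : ℝ)) := by
  have hdpos : 0 < a.den := a.den_pos
  refine IsAlgebraic.of_pow hdpos ?_
  have hand : (a : ℝ) = (a.num : ℝ) / (a.den : ℝ) := by exact_mod_cast (Rat.num_div_den a).symm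
  have : ((2 : ℝ) ^ (a : ℝ)) ^ (a.den : ℕ) = (((2 : ℚ) ^ (a.num : ℤ) : ℚ) : ℝ) := by
    rw [← Real.rpow_natCast, ← Real.rpow_mul two_pos.le, hand]
    have : (a.num : ℝ) / (a.den : ℝ) * (a.den : ℕ) = (a.num : ℤ) := by
      field_simp
    rw [this, Real.rpow_intCast]
    push_cast
    rfl
  rw [this]
  exact isAlgebraic_algebraMap _

/-- **`ln 3 ≠ a·ln 2 + b` for rational `a, b`**: for `b ≠ 0` the number `e^b = 3·2^{-a}` would be
algebraic, against Hermite–Lindemann; for `b = 0`, `3 = 2^a` is impossible. [cite: BakerTNT1975, Ch. 1 Thm 1.4] -/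
theorem log_three_ne_rat_mul_log_two_add (a b : ℚ) :
    Real.log 3 ≠ (a : ℝ) * Real.log 2 + (b : ℝ) := by
  intro h
  by_cases hb : b = 0
  · apply three_ne_two_rpow_ratCast a
    rw [Real.rpow_def_of_pos two_pos, mul_comm, ← Real.exp_log three_pos, h, hb]
    push_cast
    ring_nf
  · have hexp : Real.exp b = 3 * ((2 : ℝ) ^ (a : ℝ))⁻¹ := by
      rw [Real.rpow_def_of_pos two_pos, ← Real.exp_neg, ← Real.exp_log three_pos, ← Real.exp_add]
      congr 1
      linarith
    have halg : IsAlgebraic ℚ (Real.exp b) := by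
      rw [hexp]
      exact (isAlgebraic_nat 3).mul (isAlgebraic_two_rpow_ratCast a).inv
    have halgC : IsAlgebraic ℚ (Complex.exp (b : ℂ)) := by
      have hb' : Complex.exp (b : ℂ) = ((Real.exp b : ℝ) : ℂ) := by
        rw [Complex.ofReal_exp]; push_cast; rfl
      rw [hb']
      exact halg.algebraMap
    have hbalg : IsAlgebraic ℚ (b : ℂ) := by
      simpa using isAlgebraic_algebraMap (R := ℚ) (A := ℂ) b
    have hbne : (b : ℂ) ≠ 0 := by exact_mod_cast hb
    exact Literature.NumberTheory.Transcendental.transcendental_exp_holds hbalg hbne halgC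

/-! ## §2 Polynomial bookkeeping: Taylor coefficients along a line -/

-- `[T^k] p(aT) = p_k a^k` is `Literature.Algebra.Polynomial.coeff_comp_C_mul_X` (AffineSliceCalculus).

/-- **Taylor along the line `c + dT`**: `(f(c + dT))_k = d^k · (H_k f)(c)` (Hasse derivative). [folklore] -/
theorem coeff_comp_line {R : Type*} [CommRing R] (f : R[X]) (c d : R) (k : ℕ) :
    (f.comp (C c + C d * X)).coeff k = d ^ k * (hasseDeriv k f).eval c := by
  have h : f.comp (C c + C d * X) = (taylor c f).comp (C d * X) := by
    rw [taylor_apply, comp_assoc, add_comp, X_comp, C_comp, add_comm]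
  rw [h, Literature.Algebra.Polynomial.coeff_comp_C_mul_X, taylor_coeff, mul_comm]

/-- The value `(H_m f)(c)` when `deg f = m + 1`: `f_m + (m+1) f_{m+1} c`. [folklore] -/
theorem hasseDeriv_eval_of_natDegree_eq_succ {R : Type*} [CommRing R] (f : R[X]) {m : ℕ}
    (hf : f.natDegree = m + 1) (c : R) :
    (hasseDeriv m f).eval c = f.coeff m + (m + 1 : ℕ) * f.coeff (m + 1) * c := by
  have hdeg : (hasseDeriv m f).natDegree < 2 := by
    have := natDegree_hasseDeriv_le f m
    omega
  rw [eval_eq_sum_range' hdeg, Finset.sum_range_succ, Finset.sum_range_one, hasseDeriv_coeff,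
    hasseDeriv_coeff, zero_add, Nat.choose_self, add_comm 1 m, Nat.choose_succ_self_right]
  push_cast
  ring

/-! ## §3 Finiteness of the polynomial relation sets -/

/-- Conjugation commutes with evaluation of an integer polynomial. [folklore] -/
theorem conj_eval_map_int (S : ℤ[X]) (z : ℂ) :
    (starRingEnd ℂ) ((S.map (Int.castRingHom ℂ)).eval z) =
      (S.map (Int.castRingHom ℂ)).eval ((starRingEnd ℂ) z) := by
  rw [eval_map, eval_map, hom_eval₂]
  congr 1
  exact RingHom.ext_int _ _

/-- `aeval x S = (S.map ℤ→ℂ).eval x`. [folklore] -/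
theorem aeval_eq_eval_map_int (S : ℤ[X]) (x : ℂ) :
    Polynomial.aeval x S = (S.map (Int.castRingHom ℂ)).eval x := by
  rw [eval_map, aeval_def, algebraMap_int_eq]

/-- The reflected line polynomial `E(T) = p(T) + p(-T) − 2ℓ`, `p(T) = f(c + dT)`: its value. -/
theorem eval_linePoly_add_reflect (f : ℂ[X]) (c d ℓ t : ℂ) :
    (f.comp (C c + C d * X) + (f.comp (C c + C d * X)).comp (C (-1) * X) - C (2 * ℓ)).eval t =
      f.eval (c + d * t) + f.eval (c - d * t) - 2 * ℓ := by
  simp only [eval_sub, eval_add, eval_comp, eval_mul, eval_C, eval_X]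
  ring_nf

/-- Its coefficients: `E_k = (1 + (-1)^k) d^k (H_k f)(c) − [k = 0]·2ℓ`. -/
theorem coeff_linePoly_add_reflect (f : ℂ[X]) (c d ℓ : ℂ) (k : ℕ) :
    (f.comp (C c + C d * X) + (f.comp (C c + C d * X)).comp (C (-1) * X) - C (2 * ℓ)).coeff k =
      (1 + (-1) ^ k) * (d ^ k * (hasseDeriv k f).eval c) - if k = 0 then 2 * ℓ else 0 := by
  rw [coeff_sub, coeff_add, Literature.Algebra.Polynomial.coeff_comp_C_mul_X, coeff_comp_line, coeff_C]
  ring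

/-- **The key non-vanishing.**  For `S ∈ ℤ[X]`, `c = ln 2`, `d = 2πi`, `ℓ = ln 3`, the polynomial
`E(T) = S(c + dT) + S(c − dT) − 2ℓ` is not zero.  (`E = 0` forces `(H_k S)(ln 2) = 0` for even
`k ≥ 2` and `S(ln 2) = ln 3`: even degree kills the leading coefficient, odd degree `≥ 3` makes
`ln 2` rational, degree `≤ 1` contradicts `log_three_ne_rat_mul_log_two_add`.) -/
theorem linePoly_add_reflect_ne_zero (S : ℤ[X]) :
    (S.map (Int.castRingHom ℂ)).comp (C (Real.log 2 : ℂ) + C (2 * Real.pi * Complex.I) * X) +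
        ((S.map (Int.castRingHom ℂ)).comp (C (Real.log 2 : ℂ) + C (2 * Real.pi * Complex.I) * X)).comp
          (C (-1) * X) - C (2 * (Real.log 3 : ℂ)) ≠ 0 := by
  set f : ℂ[X] := S.map (Int.castRingHom ℂ) with hfdef
  set c : ℂ := (Real.log 2 : ℂ)
  set d : ℂ := 2 * Real.pi * Complex.I with hddef
  set ℓ : ℂ := (Real.log 3 : ℂ)
  intro hE
  have hcoeff : ∀ k, (1 + (-1 : ℂ) ^ k) * (d ^ k * (hasseDeriv k f).eval c) -
      (if k = 0 then 2 * ℓ else 0) = 0 := fun k => by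
    rw [← coeff_linePoly_add_reflect f c d ℓ k, hE, coeff_zero]
  have hd : d ≠ 0 := by
    rw [hddef]; exact two_pi_I_ne_zero'
  have hfdeg : f.natDegree = S.natDegree := by
    rw [hfdef, natDegree_map_eq_of_injective (Int.castRingHom ℂ).injective_int]
  have hfcoeff : ∀ k, f.coeff k = (S.coeff k : ℂ) := fun k => by
    rw [hfdef, coeff_map]; rfl
  -- the constant coefficient: S(c) = ℓ
  have h0 : f.eval c = ℓ := by
    have := hcoeff 0
    simp only [pow_zero, hasseDeriv_zero', one_mul, if_true] at this
    linear_combination this / 2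
  -- even coefficients k ≥ 2 vanish
  have heven : ∀ k, k ≠ 0 → Even k → (hasseDeriv k f).eval c = 0 := by
    intro k hk hke
    have := hcoeff k
    rw [if_neg hk, sub_zero, hke.neg_one_pow] at this
    have h2 : (1 + 1 : ℂ) * d ^ k ≠ 0 := mul_ne_zero (by norm_num) (pow_ne_zero _ hd)
    have : ((1 + 1 : ℂ) * d ^ k) * (hasseDeriv k f).eval c = 0 := by
      linear_combination this
    exact (mul_eq_zero.1 this).resolve_left h2
  -- case analysis on the degree
  rcases Nat.lt_or_ge S.natDegree 2 with hlt | hge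
  · -- degree ≤ 1 : S(c) = a₀ + a₁ c = ℓ
    have hdeg : f.natDegree < 2 := by rw [hfdeg]; exact hlt
    have heval : f.eval c = (S.coeff 0 : ℂ) + (S.coeff 1 : ℂ) * c := by
      rw [eval_eq_sum_range' hdeg, Finset.sum_range_succ, Finset.sum_range_one, hfcoeff, hfcoeff]
      ring
    apply log_three_ne_rat_mul_log_two_add (S.coeff 1 : ℚ) (S.coeff 0 : ℚ)
    have h' : ℓ = (S.coeff 0 : ℂ) + (S.coeff 1 : ℂ) * c := h0 ▸ heval
    apply Complex.ofReal_injective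
    push_cast
    linear_combination h'
  · rcases Nat.even_or_odd S.natDegree with hev | hodd
    · -- even degree ≥ 2 : leading coefficient dies
      have hk := heven S.natDegree (by omega) hev
      rw [← hfdeg, hasseDeriv_natDegree_eq_C, eval_C, leadingCoeff_eq_zero] at hk
      have : f.natDegree = 0 := by rw [hk, natDegree_zero]
      omega
    · -- odd degree n = m + 1 ≥ 3 : (H_m f)(c) = a_m + (m+1) a_{m+1} c = 0 makes c rational
      obtain ⟨m, hm⟩ : ∃ m, S.natDegree = m + 1 := ⟨S.natDegree - 1, by omega⟩
      have hmeven : Even m := by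
        rcases hodd with ⟨r, hr⟩; exact ⟨r, by omega⟩
      have hm0 : m ≠ 0 := by omega
      have hk := heven m hm0 hmeven
      rw [hasseDeriv_eval_of_natDegree_eq_succ f (hfdeg.trans hm) c, hfcoeff, hfcoeff] at hk
      have hlead : (S.coeff (m + 1) : ℂ) ≠ 0 := by
        have : S.coeff (m + 1) ≠ 0 := by
          rw [← hm]; exact leadingCoeff_ne_zero.2 (by rintro rfl; simp at hm)
        exact_mod_cast this
      have hmne : ((m + 1 : ℕ) : ℂ) ≠ 0 := Nat.cast_ne_zero.2 (Nat.succ_ne_zero m)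
      -- c = - a_m / ((m+1) a_{m+1})
      have hmne' : (m : ℂ) + 1 ≠ 0 := by exact_mod_cast Nat.succ_ne_zero m
      apply log_two_ne_ratCast (-(S.coeff m : ℚ) / ((m + 1 : ℕ) * (S.coeff (m + 1) : ℚ)))
      apply Complex.ofReal_injective
      push_cast at hk ⊢
      field_simp
      linear_combination hk

/-- **Finiteness, unconditionally.** For every `S ∈ ℤ[X]`, only finitely many `x` with `e^x = 2`
have `e^{S(x)} = 3`. [cite: BakerTNT1975, Ch. 1 Thm 1.4 (the only transcendence input)] -/
theorem finite_polyRelationSet (S : ℤ[X]) :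
    {x : ℂ | Complex.exp x = 2 ∧ Complex.exp (Polynomial.aeval x S) = 3}.Finite := by
  set f : ℂ[X] := S.map (Int.castRingHom ℂ) with hfdef
  set c : ℂ := (Real.log 2 : ℂ) with hcdef
  set d : ℂ := 2 * Real.pi * Complex.I with hddef
  set ℓ : ℂ := (Real.log 3 : ℂ) with hℓdef
  set E : ℂ[X] := f.comp (C c + C d * X) + (f.comp (C c + C d * X)).comp (C (-1) * X) - C (2 * ℓ)
    with hEdef
  have hE : E ≠ 0 := linePoly_add_reflect_ne_zero S
  refine ((E.finite_setOf_isRoot hE).image fun t : ℂ => c + d * t).subset ?_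
  rintro x ⟨hx, hS⟩
  obtain ⟨j, rfl⟩ := mem_logTwoBranches_iff.1 hx
  refine ⟨(j : ℂ), ?_, by rw [hcdef, hddef]; ring⟩
  -- `S(x_j) = ℓ + k d`
  have hS' : ∃ k : ℤ, Polynomial.aeval ((Real.log 2 : ℂ) + j * (2 * Real.pi * Complex.I)) S =
      ℓ + k * (2 * Real.pi * Complex.I) := by
    rw [← exp_log_three, Complex.exp_eq_exp_iff_exists_int] at hS
    exact hS
  obtain ⟨k, hk⟩ := hS'
  rw [aeval_eq_eval_map_int] at hk
  have hxj : (Real.log 2 : ℂ) + j * (2 * Real.pi * Complex.I) = c + d * j := by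
    rw [hcdef, hddef]; ring
  rw [hxj] at hk
  -- conjugate: `S(c - d j) = ℓ - k d`
  have hconj : f.eval (c - d * j) = ℓ - k * d := by
    have h1 := conj_eval_map_int S (c + d * j)
    rw [← hfdef, hk] at h1
    have hcz : (starRingEnd ℂ) (c + d * j) = c - d * j := by
      rw [hcdef, hddef]
      simp only [map_add, map_mul, Complex.conj_ofReal, Complex.conj_I, map_intCast, map_ofNat]
      ring
    have hcl : (starRingEnd ℂ) (ℓ + k * (2 * Real.pi * Complex.I)) = ℓ - k * d := by
      rw [hℓdef, hddef]
      simp only [map_add, map_mul, Complex.conj_ofReal, Complex.conj_I, map_intCast, map_ofNat]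
      ring
    rw [hcz, hcl] at h1
    exact h1.symm
  show E.IsRoot (j : ℂ)
  rw [IsRoot.def, hEdef, eval_linePoly_add_reflect, hk, hconj, hddef]
  ring

/-! ## §4 Wiring to the hub: polynomial relations make `ln 2` definable, unconditionally -/

/-- One-variable integer polynomial maps are `∅`-definable functions of any coordinate. [folklore] -/
theorem definableFun_polynomial_aeval {α : Type*} (S : ℤ[X]) (i : α) :
    (∅ : Set ℂ).DefinableFun Language.expRing (fun v : α → ℂ => Polynomial.aeval (v i) S) := by
  induction S using Polynomial.induction_on' with
  | add p q hp hq => simpa using definableFun_add' hp hq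
  | monomial n a =>
    have hpow : ∀ m : ℕ, (∅ : Set ℂ).DefinableFun Language.expRing (fun v : α → ℂ => v i ^ m) := by
      intro m
      induction m with
      | zero => simpa using (definableFun_one' (A := (∅ : Set ℂ)) (α := α))
      | succ m ih => simpa [pow_succ] using definableFun_mul' ih (definableFun_proj_params i)
    simpa [Polynomial.aeval_monomial] using definableFun_mul' (definableFun_intCast' a) (hpow n)

/-- The polynomial relation set `{x | e^x = 2 ∧ e^{S(x)} = 3}` is `∅`-definable. -/
theorem definable₁_polyRelationSet (S : ℤ[X]) :
    Set.Definable₁ (∅ : Set ℂ) Language.expRing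
      {x : ℂ | Complex.exp x = 2 ∧ Complex.exp (Polynomial.aeval x S) = 3} := by
  unfold Set.Definable₁
  simp only [Set.mem_setOf_eq]
  have h2 : (∅ : Set ℂ).DefinableFun Language.expRing (fun _ : Fin 1 → ℂ => (2 : ℂ)) := by
    simpa using definableFun_natCast' (A := (∅ : Set ℂ)) (α := Fin 1) 2
  have h3 : (∅ : Set ℂ).DefinableFun Language.expRing (fun _ : Fin 1 → ℂ => (3 : ℂ)) := by
    simpa using definableFun_natCast' (A := (∅ : Set ℂ)) (α := Fin 1) 3
  refine definable_setOf_and_params ?_ ?_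
  · exact definable_setOf_eq_params (definableFun_cexp (definableFun_proj_params _)) h2
  · exact definable_setOf_eq_params (definableFun_cexp (definableFun_polynomial_aeval S 0)) h3

/-- **A polynomial relation `S(ln 2 + 2πij) = ln 3 + 2πik` makes `ln 2` pointwise `∅`-definable —
unconditionally** (finiteness §3 + conjugation averaging). -/
theorem log_two_mem_expDcl_of_polyRelation (S : ℤ[X]) {j k : ℤ}
    (hrel : Polynomial.aeval ((Real.log 2 : ℂ) + j * (2 * Real.pi * Complex.I)) S =
      (Real.log 3 : ℂ) + k * (2 * Real.pi * Complex.I)) :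
    (Real.log 2 : ℂ) ∈ expDcl := by
  refine log_two_mem_expDcl_of_finite_definable_subset (finite_polyRelationSet S)
    (definable₁_polyRelationSet S) (fun _ h => h.1) ⟨_, log_two_add_mem_logTwoBranches j, ?_⟩
  show Complex.exp (Polynomial.aeval ((Real.log 2 : ℂ) + j * (2 * Real.pi * Complex.I)) S) = 3
  rw [hrel, Complex.exp_add, exp_log_three, Complex.exp_int_mul_two_pi_mul_I, mul_one]

/-- Hence (A) and one polynomial relation force `ln 2 ∈ C_EA`. -/
theorem log_two_mem_logFreeCore_of_crux_of_polyRelation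
    (hA : Summit.Schanuel.Schanuel.Theses.RigidCore.AclSubsetLogFreeCore) (S : ℤ[X]) {j k : ℤ}
    (hrel : Polynomial.aeval ((Real.log 2 : ℂ) + j * (2 * Real.pi * Complex.I)) S =
      (Real.log 3 : ℂ) + k * (2 * Real.pi * Complex.I)) :
    (Real.log 2 : ℂ) ∈ logFreeCore :=
  log_two_mem_logFreeCore_of_crux hA (log_two_mem_expDcl_of_polyRelation S hrel)

/-- **UNCONDITIONAL CALIBRATION: (A) is not soft.**  (A) implies: `ln 2 ∈ C_EA` (false under
Schanuel's conjecture) OR no branch of `log 3` is an integer polynomial in a branch of `log 2`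
(open: already `ln 3 ∉ {m ln²2 + r}` is unknown).  No Baker / Theorem L input. -/
theorem logFree_or_noPolyRelation_of_crux
    (hA : Summit.Schanuel.Schanuel.Theses.RigidCore.AclSubsetLogFreeCore) :
    (Real.log 2 : ℂ) ∈ logFreeCore ∨
      ∀ (S : ℤ[X]) (j k : ℤ),
        Polynomial.aeval ((Real.log 2 : ℂ) + j * (2 * Real.pi * Complex.I)) S ≠
          (Real.log 3 : ℂ) + k * (2 * Real.pi * Complex.I) := by
  by_cases h : (Real.log 2 : ℂ) ∈ logFreeCore
  · exact Or.inl h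
  · exact Or.inr fun S j k hrel => h (log_two_mem_logFreeCore_of_crux_of_polyRelation hA S hrel)

/-- **Symmetry ⇒ transcendence, unconditionally:** one automorphism of `ℂ_exp` moving `ln 2`
implies `ln 3 + 2πik ∉ ℤ[ln 2 + 2πij]` for all `j, k` — a statement about two logarithms of
algebraic numbers beyond Baker's linear forms. -/
theorem noPolyRelation_of_equiv_apply_ne (σ : Language.expRing.Equiv ℂ ℂ)
    (h : σ (Real.log 2 : ℂ) ≠ Real.log 2) (S : ℤ[X]) (j k : ℤ) :
    Polynomial.aeval ((Real.log 2 : ℂ) + j * (2 * Real.pi * Complex.I)) S ≠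
      (Real.log 3 : ℂ) + k * (2 * Real.pi * Complex.I) := fun hrel =>
  log_two_not_mem_expDcl_of_equiv_apply_ne σ h (log_two_mem_expDcl_of_polyRelation S hrel)

/-- The KMO form: if some `2^{1/n}` (`n ≥ 1`) is not pointwise `∅`-definable in `ℂ_exp`, then no
branch of `log 3` is an integer polynomial in a branch of `log 2` — unconditionally. -/
theorem noPolyRelation_of_root_two_not_mem_expDcl {n : ℕ} (hn : n ≠ 0)
    (h : (((2 : ℝ) ^ ((n : ℝ)⁻¹) : ℝ) : ℂ) ∉ expDcl) (S : ℤ[X]) (j k : ℤ) :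
    Polynomial.aeval ((Real.log 2 : ℂ) + j * (2 * Real.pi * Complex.I)) S ≠
      (Real.log 3 : ℂ) + k * (2 * Real.pi * Complex.I) := fun hrel =>
  h (root_two_mem_expDcl_of_log_two_mem_expDcl (log_two_mem_expDcl_of_polyRelation S hrel) hn)

end Summit.Schanuel.Schanuel.Theorems.AclSubsetLogFreeCore.Negative
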